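import Mathlib.Analysis.SpecialFunctions.Trigonometric.Basic
import Mathlib.Tactic.Ring
import Mathlib.Tactic.FinCases
import Mathlib.Tactic.LinearCombination
import Mathlib.Algebra.BigOperators.Fin

/-!
# Stub `stub_pseudotensorBound` (line `sublinear-is-free-clean-window-charges`), part 5:
# the polynomial identities — splitting and Landau–Lifshitz's principal-symbol cancellation

Helper file for `stmt-FinalStateConjecture-10166` (crux `InertialRecession`). Pure algebra over `ℝ`
in the `2`-jet variables of a field of symmetric bilinear forms on `ℝ⁴` at a point:
`D = det (g_{μν})`, `u i j = g^{ij}` (symmetric), `d a i j = ∂_a g_{ij}`,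
`dd a b i j = ∂_a ∂_b g_{ij}` (symmetric in `(a,b)` and in `(i,j)`). With the explicit polynomials of
parts 3–4 (generated from one template, hence repeated verbatim here):

* `ricciRaw_split`, `einsteinRaw_split` — the raw expansions of `R_{ij}` and `G^{μν}` are the sum of a
  part LINEAR in `dd` and a part QUADRATIC in `d`;
* `symbol_identity` — **LL's lemma (96.1)–(96.4) as a polynomial identity**: the `dd`-linear part of
  `Σ_{αβ} ∂_α∂_β H^{μβνα}` plus `2 D` times the `dd`-linear part of `G^{μν}` vanishes identically
  (for symmetric `u`, `dd`); i.e. the second derivatives cancel in `(−g)(8π t^{μν}_LL)`, which is why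
  (96.8)/(96.9) contain first derivatives only. Checked numerically first in exact rationals
  (job `ptb-symbolcheck`), proved here by `ring` componentwise;
* `density_identity` — consequently `−Σ_α (16π)⁻¹ Σ_β (LIN+QUAD) − (8π)⁻¹ D (GLIN+GQUAD)
  = −Σ_α (16π)⁻¹ Σ_β QUAD − (8π)⁻¹ D GQUAD`: only the quadratic parts survive in `g · t^{μν}_LL`.
-/

set_option linter.unusedSimpArgs false
set_option maxRecDepth 16384

namespace Summit.FinalStateConjecture.FinalStateConjecture.Theorems.SublinearIsFree.PseudotensorBound

set_option linter.dupNamespace false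

variable (D : ℝ) (u : Fin 4 → Fin 4 → ℝ) (d : Fin 4 → Fin 4 → Fin 4 → ℝ)
  (dd : Fin 4 → Fin 4 → Fin 4 → Fin 4 → ℝ)

set_option maxHeartbeats 4000000 in
/-- **Splitting of the raw Ricci expansion**: `R_{ij} = RLIN_{ij}(dd) + RQUAD_{ij}(d, d)`.
[cite: LandauLifshitz1975, §92 (92.7)] -/
theorem ricciRaw_split (i j : Fin 4) :
    ∑ c, (2⁻¹ * (∑ l, (-((∑ v1, ∑ v2, u c v1 * u v2 l * d c v1 v2) * (d i j l + d j l i - d l i j))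
      + u c l * (dd c i j l + dd c j l i - dd c l i j))) - 2⁻¹ * (∑ l, (-((∑ v1, ∑ v2, u c v1 * u v2
      l * d i v1 v2) * (d c j l + d j l c - d l c j)) + u c l * (dd i c j l + dd i j l c - dd i l c
      j))) + (∑ m, 2⁻¹ * (∑ l, u m l * (d i j l + d j l i - d l i j)) * (2⁻¹ * (∑ l, u c l * (d c m
      l + d m l c - d l c m)))) - (∑ m, 2⁻¹ * (∑ l, u m l * (d c j l + d j l c - d l c j)) * (2⁻¹ *
      (∑ l, u c l * (d i m l + d m l i - d l i m))))) =
    ∑ c, (2⁻¹ * (∑ l, u c l * (dd c i j l + dd c j l i - dd c l i j)) - 2⁻¹ * (∑ l, u c l * (dd i c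
      j l + dd i j l c - dd i l c j)))
    +
    (∑ c, (2⁻¹ * (∑ l, -((∑ v1, ∑ v2, u c v1 * u v2 l * d c v1 v2) * (d i j l + d j l i - d l i j)))
      - 2⁻¹ * (∑ l, -((∑ v1, ∑ v2, u c v1 * u v2 l * d i v1 v2) * (d c j l + d j l c - d l c j))) +
      (∑ m, (2⁻¹ * (∑ l, u m l * (d i j l + d j l i - d l i j)) * (2⁻¹ * (∑ l, u c l * (d c m l + d
      m l c - d l c m))) - 2⁻¹ * (∑ l, u m l * (d c j l + d j l c - d l c j)) * (2⁻¹ * (∑ l, u c l *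
      (d i m l + d m l i - d l i m))))))) := by
  simp only [Fin.sum_univ_four]
  ring

/-- **Splitting of the raw Einstein expansion**: `G^{μν} = GLIN^{μν}(dd) + GQUAD^{μν}(d, d)`.
[cite: LandauLifshitz1975, §96 (96.7)] -/
theorem einsteinRaw_split (μ ν : Fin 4) :
    (∑ a1, ∑ a2, u μ a1 * u ν a2 * (∑ c, (2⁻¹ * (∑ l, (-((∑ v1, ∑ v2, u c v1 * u v2 l * d c v1 v2) *
      (d a1 a2 l + d a2 l a1 - d l a1 a2)) + u c l * (dd c a1 a2 l + dd c a2 l a1 - dd c l a1 a2)))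
      - 2⁻¹ * (∑ l, (-((∑ v1, ∑ v2, u c v1 * u v2 l * d a1 v1 v2) * (d c a2 l + d a2 l c - d l c
      a2)) + u c l * (dd a1 c a2 l + dd a1 a2 l c - dd a1 l c a2))) + (∑ m, 2⁻¹ * (∑ l, u m l * (d
      a1 a2 l + d a2 l a1 - d l a1 a2)) * (2⁻¹ * (∑ l, u c l * (d c m l + d m l c - d l c m)))) - (∑
      m, 2⁻¹ * (∑ l, u m l * (d c a2 l + d a2 l c - d l c a2)) * (2⁻¹ * (∑ l, u c l * (d a1 m l + d
      m l a1 - d l a1 m))))))) - 2⁻¹ * u μ ν * (∑ a1, ∑ a2, u a1 a2 * (∑ c, (2⁻¹ * (∑ l, (-((∑ v1, ∑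
      v2, u c v1 * u v2 l * d c v1 v2) * (d a1 a2 l + d a2 l a1 - d l a1 a2)) + u c l * (dd c a1 a2
      l + dd c a2 l a1 - dd c l a1 a2))) - 2⁻¹ * (∑ l, (-((∑ v1, ∑ v2, u c v1 * u v2 l * d a1 v1 v2)
      * (d c a2 l + d a2 l c - d l c a2)) + u c l * (dd a1 c a2 l + dd a1 a2 l c - dd a1 l c a2))) +
      (∑ m, 2⁻¹ * (∑ l, u m l * (d a1 a2 l + d a2 l a1 - d l a1 a2)) * (2⁻¹ * (∑ l, u c l * (d c m l
      + d m l c - d l c m)))) - (∑ m, 2⁻¹ * (∑ l, u m l * (d c a2 l + d a2 l c - d l c a2)) * (2⁻¹ *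
      (∑ l, u c l * (d a1 m l + d m l a1 - d l a1 m))))))) =
    (∑ a1, ∑ a2, u μ a1 * u ν a2 * (∑ c, (2⁻¹ * (∑ l, u c l * (dd c a1 a2 l + dd c a2 l a1 - dd c l
      a1 a2)) - 2⁻¹ * (∑ l, u c l * (dd a1 c a2 l + dd a1 a2 l c - dd a1 l c a2))))) - 2⁻¹ * u μ ν *
      (∑ a1, ∑ a2, u a1 a2 * (∑ c, (2⁻¹ * (∑ l, u c l * (dd c a1 a2 l + dd c a2 l a1 - dd c l a1
      a2)) - 2⁻¹ * (∑ l, u c l * (dd a1 c a2 l + dd a1 a2 l c - dd a1 l c a2)))))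
    +
    ((∑ a1, ∑ a2, u μ a1 * u ν a2 * (∑ c, (2⁻¹ * (∑ l, -((∑ v1, ∑ v2, u c v1 * u v2 l * d c v1 v2) *
      (d a1 a2 l + d a2 l a1 - d l a1 a2))) - 2⁻¹ * (∑ l, -((∑ v1, ∑ v2, u c v1 * u v2 l * d a1 v1
      v2) * (d c a2 l + d a2 l c - d l c a2))) + (∑ m, (2⁻¹ * (∑ l, u m l * (d a1 a2 l + d a2 l a1 -
      d l a1 a2)) * (2⁻¹ * (∑ l, u c l * (d c m l + d m l c - d l c m))) - 2⁻¹ * (∑ l, u m l * (d c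
      a2 l + d a2 l c - d l c a2)) * (2⁻¹ * (∑ l, u c l * (d a1 m l + d m l a1 - d l a1 m)))))))) -
      2⁻¹ * u μ ν * (∑ a1, ∑ a2, u a1 a2 * (∑ c, (2⁻¹ * (∑ l, -((∑ v1, ∑ v2, u c v1 * u v2 l * d c
      v1 v2) * (d a1 a2 l + d a2 l a1 - d l a1 a2))) - 2⁻¹ * (∑ l, -((∑ v1, ∑ v2, u c v1 * u v2 l *
      d a1 v1 v2) * (d c a2 l + d a2 l c - d l c a2))) + (∑ m, (2⁻¹ * (∑ l, u m l * (d a1 a2 l + d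
      a2 l a1 - d l a1 a2)) * (2⁻¹ * (∑ l, u c l * (d c m l + d m l c - d l c m))) - 2⁻¹ * (∑ l, u m
      l * (d c a2 l + d a2 l c - d l c a2)) * (2⁻¹ * (∑ l, u c l * (d a1 m l + d m l a1 - d l a1
      m))))))))) := by
  simp only [ricciRaw_split]
  set RL : Fin 4 → Fin 4 → ℝ :=
    fun a1 a2 ↦ ∑ c, (2⁻¹ * (∑ l, u c l * (dd c a1 a2 l + dd c a2 l a1 - dd c l a1 a2)) - 2⁻¹ * (∑
      l, u c l * (dd a1 c a2 l + dd a1 a2 l c - dd a1 l c a2))) with hRL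
  set RQ : Fin 4 → Fin 4 → ℝ :=
    fun a1 a2 ↦ ∑ c, (2⁻¹ * (∑ l, -((∑ v1, ∑ v2, u c v1 * u v2 l * d c v1 v2) * (d a1 a2 l + d a2 l
      a1 - d l a1 a2))) - 2⁻¹ * (∑ l, -((∑ v1, ∑ v2, u c v1 * u v2 l * d a1 v1 v2) * (d c a2 l + d
      a2 l c - d l c a2))) + (∑ m, (2⁻¹ * (∑ l, u m l * (d a1 a2 l + d a2 l a1 - d l a1 a2)) * (2⁻¹
      * (∑ l, u c l * (d c m l + d m l c - d l c m))) - 2⁻¹ * (∑ l, u m l * (d c a2 l + d a2 l c - d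
      l c a2)) * (2⁻¹ * (∑ l, u c l * (d a1 m l + d m l a1 - d l a1 m)))))) with hRQ
  show (∑ a1, ∑ a2, u μ a1 * u ν a2 * (RL a1 a2 + RQ a1 a2))
      - 2⁻¹ * u μ ν * (∑ a1, ∑ a2, u a1 a2 * (RL a1 a2 + RQ a1 a2)) =
    ((∑ a1, ∑ a2, u μ a1 * u ν a2 * RL a1 a2) - 2⁻¹ * u μ ν * (∑ a1, ∑ a2, u a1 a2 * RL a1 a2))
    + ((∑ a1, ∑ a2, u μ a1 * u ν a2 * RQ a1 a2) - 2⁻¹ * u μ ν * (∑ a1, ∑ a2, u a1 a2 * RQ a1 a2))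
  simp only [mul_add, Finset.sum_add_distrib]
  ring

set_option maxHeartbeats 8000000 in
/-- **The principal symbols cancel (Landau–Lifshitz (96.1)–(96.4))**: for symmetric `u` and `dd`
symmetric in both index pairs, the `dd`-linear part of `Σ_{αβ} ∂_α∂_β H^{μβνα}` plus `2D` times the
`dd`-linear part of `G^{μν}` is identically zero. [cite: LandauLifshitz1975, §96 (96.4)] -/
theorem symbol_identity (hu : ∀ i j, u i j = u j i) (hdd₁ : ∀ a b i j, dd a b i j = dd b a i j)
    (hdd₂ : ∀ a b i j, dd a b i j = dd a b j i) (μ ν : Fin 4) :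
    (∑ α, ∑ β,
      (
      (-(D * (∑ t1, ∑ t2, u t1 t2 * dd α β t2 t1))) * (u μ ν * u β α - u β ν * u μ α) + D * ((∑ w1,
        ∑ w2, u μ w1 * u w2 ν * dd α β w1 w2) * u β α + u μ ν * (∑ w1, ∑ w2, u β w1 * u w2 α * dd α
        β w1 w2) - (∑ w1, ∑ w2, u β w1 * u w2 ν * dd α β w1 w2) * u μ α - u β ν * (∑ w1, ∑ w2, u μ
        w1 * u w2 α * dd α β w1 w2))))
    + 2 * D *
      (
      (∑ a1, ∑ a2, u μ a1 * u ν a2 * (∑ c, (2⁻¹ * (∑ l, u c l * (dd c a1 a2 l + dd c a2 l a1 - dd c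
        l a1 a2)) - 2⁻¹ * (∑ l, u c l * (dd a1 c a2 l + dd a1 a2 l c - dd a1 l c a2))))) - 2⁻¹ * u μ
        ν * (∑ a1, ∑ a2, u a1 a2 * (∑ c, (2⁻¹ * (∑ l, u c l * (dd c a1 a2 l + dd c a2 l a1 - dd c l
        a1 a2)) - 2⁻¹ * (∑ l, u c l * (dd a1 c a2 l + dd a1 a2 l c - dd a1 l c a2)))))) = 0 := by
  have hu10 : u 1 0 = u 0 1 := hu 1 0
  have hu20 : u 2 0 = u 0 2 := hu 2 0
  have hu30 : u 3 0 = u 0 3 := hu 3 0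
  have hu21 : u 2 1 = u 1 2 := hu 2 1
  have hu31 : u 3 1 = u 1 3 := hu 3 1
  have hu32 : u 3 2 = u 2 3 := hu 3 2
  have hd10 : ∀ i j, dd 1 0 i j = dd 0 1 i j := fun i j ↦ hdd₁ 1 0 i j
  have hd20 : ∀ i j, dd 2 0 i j = dd 0 2 i j := fun i j ↦ hdd₁ 2 0 i j
  have hd30 : ∀ i j, dd 3 0 i j = dd 0 3 i j := fun i j ↦ hdd₁ 3 0 i j
  have hd21 : ∀ i j, dd 2 1 i j = dd 1 2 i j := fun i j ↦ hdd₁ 2 1 i j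
  have hd31 : ∀ i j, dd 3 1 i j = dd 1 3 i j := fun i j ↦ hdd₁ 3 1 i j
  have hd32 : ∀ i j, dd 3 2 i j = dd 2 3 i j := fun i j ↦ hdd₁ 3 2 i j
  have he10 : ∀ a b, dd a b 1 0 = dd a b 0 1 := fun a b ↦ hdd₂ a b 1 0
  have he20 : ∀ a b, dd a b 2 0 = dd a b 0 2 := fun a b ↦ hdd₂ a b 2 0
  have he30 : ∀ a b, dd a b 3 0 = dd a b 0 3 := fun a b ↦ hdd₂ a b 3 0
  have he21 : ∀ a b, dd a b 2 1 = dd a b 1 2 := fun a b ↦ hdd₂ a b 2 1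
  have he31 : ∀ a b, dd a b 3 1 = dd a b 1 3 := fun a b ↦ hdd₂ a b 3 1
  have he32 : ∀ a b, dd a b 3 2 = dd a b 2 3 := fun a b ↦ hdd₂ a b 3 2
  fin_cases μ <;> fin_cases ν <;>
  · simp only [Fin.sum_univ_four, Fin.isValue, Fin.zero_eta, Fin.mk_one, Fin.reduceFinMk,
      hu10, hu20, hu30, hu21, hu31, hu32, hd10, hd20, hd30, hd21, hd31, hd32,
      he10, he20, he30, he21, he31, he32]
    ring

/-- **Only the quadratic parts survive in `g · t^{μν}_LL`**: with the splittings of parts 3–5,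
`−Σ_α (16π)⁻¹ Σ_β (LIN + QUAD) − (8π)⁻¹ D (GLIN + GQUAD) = −Σ_α (16π)⁻¹ Σ_β QUAD − (8π)⁻¹ D GQUAD`.
[cite: LandauLifshitz1975, §96 (96.8)] -/
theorem density_identity (hu : ∀ i j, u i j = u j i) (hdd₁ : ∀ a b i j, dd a b i j = dd b a i j)
    (hdd₂ : ∀ a b i j, dd a b i j = dd a b j i) (μ ν : Fin 4) :
    -(∑ α, (16 * Real.pi)⁻¹ * ∑ β,
      (
      (-(D * (∑ t1, ∑ t2, u t1 t2 * dd α β t2 t1))) * (u μ ν * u β α - u β ν * u μ α) + D * ((∑ w1,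
        ∑ w2, u μ w1 * u w2 ν * dd α β w1 w2) * u β α + u μ ν * (∑ w1, ∑ w2, u β w1 * u w2 α * dd α
        β w1 w2) - (∑ w1, ∑ w2, u β w1 * u w2 ν * dd α β w1 w2) * u μ α - u β ν * (∑ w1, ∑ w2, u μ
        w1 * u w2 α * dd α β w1 w2))
      +
      ((-(D * (∑ t1, ∑ t2, u t1 t2 * d α t2 t1) * (∑ t1, ∑ t2, u t1 t2 * d β t2 t1) + D * (∑ t1, ∑
        t2, -((∑ v1, ∑ v2, u t1 v1 * u v2 t2 * d α v1 v2) * d β t2 t1)))) * (u μ ν * u β α - u β ν *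
        u μ α) + D * (∑ t1, ∑ t2, u t1 t2 * d β t2 t1) * ((∑ v1, ∑ v2, u μ v1 * u v2 ν * d α v1 v2)
        * u β α + u μ ν * (∑ v1, ∑ v2, u β v1 * u v2 α * d α v1 v2) - (∑ v1, ∑ v2, u β v1 * u v2 ν *
        d α v1 v2) * u μ α - u β ν * (∑ v1, ∑ v2, u μ v1 * u v2 α * d α v1 v2)) + D * (∑ t1, ∑ t2, u
        t1 t2 * d α t2 t1) * ((∑ v1, ∑ v2, u μ v1 * u v2 ν * d β v1 v2) * u β α + u μ ν * (∑ v1, ∑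
        v2, u β v1 * u v2 α * d β v1 v2) - (∑ v1, ∑ v2, u β v1 * u v2 ν * d β v1 v2) * u μ α - u β ν
        * (∑ v1, ∑ v2, u μ v1 * u v2 α * d β v1 v2)) + D * ((∑ w1, ∑ w2, (-((∑ v1, ∑ v2, u μ v1 * u
        v2 w1 * d α v1 v2) * u w2 ν * d β w1 w2) - u μ w1 * (∑ v1, ∑ v2, u w2 v1 * u v2 ν * d α v1
        v2) * d β w1 w2)) * u β α + (∑ v1, ∑ v2, u μ v1 * u v2 ν * d β v1 v2) * (-(∑ v1, ∑ v2, u β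
        v1 * u v2 α * d α v1 v2)) + (-(∑ v1, ∑ v2, u μ v1 * u v2 ν * d α v1 v2)) * (∑ v1, ∑ v2, u β
        v1 * u v2 α * d β v1 v2) + u μ ν * (∑ w1, ∑ w2, (-((∑ v1, ∑ v2, u β v1 * u v2 w1 * d α v1
        v2) * u w2 α * d β w1 w2) - u β w1 * (∑ v1, ∑ v2, u w2 v1 * u v2 α * d α v1 v2) * d β w1
        w2)) - (∑ w1, ∑ w2, (-((∑ v1, ∑ v2, u β v1 * u v2 w1 * d α v1 v2) * u w2 ν * d β w1 w2) - u
        β w1 * (∑ v1, ∑ v2, u w2 v1 * u v2 ν * d α v1 v2) * d β w1 w2)) * u μ α - (∑ v1, ∑ v2, u β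
        v1 * u v2 ν * d β v1 v2) * (-(∑ v1, ∑ v2, u μ v1 * u v2 α * d α v1 v2)) - (-(∑ v1, ∑ v2, u β
        v1 * u v2 ν * d α v1 v2)) * (∑ v1, ∑ v2, u μ v1 * u v2 α * d β v1 v2) - u β ν * (∑ w1, ∑ w2,
        (-((∑ v1, ∑ v2, u μ v1 * u v2 w1 * d α v1 v2) * u w2 α * d β w1 w2) - u μ w1 * (∑ v1, ∑ v2,
        u w2 v1 * u v2 α * d α v1 v2) * d β w1 w2))))))
    - (8 * Real.pi)⁻¹ * D *
      (
      (∑ a1, ∑ a2, u μ a1 * u ν a2 * (∑ c, (2⁻¹ * (∑ l, u c l * (dd c a1 a2 l + dd c a2 l a1 - dd c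
        l a1 a2)) - 2⁻¹ * (∑ l, u c l * (dd a1 c a2 l + dd a1 a2 l c - dd a1 l c a2))))) - 2⁻¹ * u μ
        ν * (∑ a1, ∑ a2, u a1 a2 * (∑ c, (2⁻¹ * (∑ l, u c l * (dd c a1 a2 l + dd c a2 l a1 - dd c l
        a1 a2)) - 2⁻¹ * (∑ l, u c l * (dd a1 c a2 l + dd a1 a2 l c - dd a1 l c a2)))))
      +
      ((∑ a1, ∑ a2, u μ a1 * u ν a2 * (∑ c, (2⁻¹ * (∑ l, -((∑ v1, ∑ v2, u c v1 * u v2 l * d c v1 v2)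
        * (d a1 a2 l + d a2 l a1 - d l a1 a2))) - 2⁻¹ * (∑ l, -((∑ v1, ∑ v2, u c v1 * u v2 l * d a1
        v1 v2) * (d c a2 l + d a2 l c - d l c a2))) + (∑ m, (2⁻¹ * (∑ l, u m l * (d a1 a2 l + d a2 l
        a1 - d l a1 a2)) * (2⁻¹ * (∑ l, u c l * (d c m l + d m l c - d l c m))) - 2⁻¹ * (∑ l, u m l
        * (d c a2 l + d a2 l c - d l c a2)) * (2⁻¹ * (∑ l, u c l * (d a1 m l + d m l a1 - d l a1
        m)))))))) - 2⁻¹ * u μ ν * (∑ a1, ∑ a2, u a1 a2 * (∑ c, (2⁻¹ * (∑ l, -((∑ v1, ∑ v2, u c v1 *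
        u v2 l * d c v1 v2) * (d a1 a2 l + d a2 l a1 - d l a1 a2))) - 2⁻¹ * (∑ l, -((∑ v1, ∑ v2, u c
        v1 * u v2 l * d a1 v1 v2) * (d c a2 l + d a2 l c - d l c a2))) + (∑ m, (2⁻¹ * (∑ l, u m l *
        (d a1 a2 l + d a2 l a1 - d l a1 a2)) * (2⁻¹ * (∑ l, u c l * (d c m l + d m l c - d l c m)))
        - 2⁻¹ * (∑ l, u m l * (d c a2 l + d a2 l c - d l c a2)) * (2⁻¹ * (∑ l, u c l * (d a1 m l + d
        m l a1 - d l a1 m))))))))))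
    = -(∑ α, (16 * Real.pi)⁻¹ * ∑ β,
      (
      (-(D * (∑ t1, ∑ t2, u t1 t2 * d α t2 t1) * (∑ t1, ∑ t2, u t1 t2 * d β t2 t1) + D * (∑ t1, ∑
        t2, -((∑ v1, ∑ v2, u t1 v1 * u v2 t2 * d α v1 v2) * d β t2 t1)))) * (u μ ν * u β α - u β ν *
        u μ α) + D * (∑ t1, ∑ t2, u t1 t2 * d β t2 t1) * ((∑ v1, ∑ v2, u μ v1 * u v2 ν * d α v1 v2)
        * u β α + u μ ν * (∑ v1, ∑ v2, u β v1 * u v2 α * d α v1 v2) - (∑ v1, ∑ v2, u β v1 * u v2 ν *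
        d α v1 v2) * u μ α - u β ν * (∑ v1, ∑ v2, u μ v1 * u v2 α * d α v1 v2)) + D * (∑ t1, ∑ t2, u
        t1 t2 * d α t2 t1) * ((∑ v1, ∑ v2, u μ v1 * u v2 ν * d β v1 v2) * u β α + u μ ν * (∑ v1, ∑
        v2, u β v1 * u v2 α * d β v1 v2) - (∑ v1, ∑ v2, u β v1 * u v2 ν * d β v1 v2) * u μ α - u β ν
        * (∑ v1, ∑ v2, u μ v1 * u v2 α * d β v1 v2)) + D * ((∑ w1, ∑ w2, (-((∑ v1, ∑ v2, u μ v1 * u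
        v2 w1 * d α v1 v2) * u w2 ν * d β w1 w2) - u μ w1 * (∑ v1, ∑ v2, u w2 v1 * u v2 ν * d α v1
        v2) * d β w1 w2)) * u β α + (∑ v1, ∑ v2, u μ v1 * u v2 ν * d β v1 v2) * (-(∑ v1, ∑ v2, u β
        v1 * u v2 α * d α v1 v2)) + (-(∑ v1, ∑ v2, u μ v1 * u v2 ν * d α v1 v2)) * (∑ v1, ∑ v2, u β
        v1 * u v2 α * d β v1 v2) + u μ ν * (∑ w1, ∑ w2, (-((∑ v1, ∑ v2, u β v1 * u v2 w1 * d α v1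
        v2) * u w2 α * d β w1 w2) - u β w1 * (∑ v1, ∑ v2, u w2 v1 * u v2 α * d α v1 v2) * d β w1
        w2)) - (∑ w1, ∑ w2, (-((∑ v1, ∑ v2, u β v1 * u v2 w1 * d α v1 v2) * u w2 ν * d β w1 w2) - u
        β w1 * (∑ v1, ∑ v2, u w2 v1 * u v2 ν * d α v1 v2) * d β w1 w2)) * u μ α - (∑ v1, ∑ v2, u β
        v1 * u v2 ν * d β v1 v2) * (-(∑ v1, ∑ v2, u μ v1 * u v2 α * d α v1 v2)) - (-(∑ v1, ∑ v2, u β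
        v1 * u v2 ν * d α v1 v2)) * (∑ v1, ∑ v2, u μ v1 * u v2 α * d β v1 v2) - u β ν * (∑ w1, ∑ w2,
        (-((∑ v1, ∑ v2, u μ v1 * u v2 w1 * d α v1 v2) * u w2 α * d β w1 w2) - u μ w1 * (∑ v1, ∑ v2,
        u w2 v1 * u v2 α * d α v1 v2) * d β w1 w2)))))
    - (8 * Real.pi)⁻¹ * D *
      (
      (∑ a1, ∑ a2, u μ a1 * u ν a2 * (∑ c, (2⁻¹ * (∑ l, -((∑ v1, ∑ v2, u c v1 * u v2 l * d c v1 v2)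
        * (d a1 a2 l + d a2 l a1 - d l a1 a2))) - 2⁻¹ * (∑ l, -((∑ v1, ∑ v2, u c v1 * u v2 l * d a1
        v1 v2) * (d c a2 l + d a2 l c - d l c a2))) + (∑ m, (2⁻¹ * (∑ l, u m l * (d a1 a2 l + d a2 l
        a1 - d l a1 a2)) * (2⁻¹ * (∑ l, u c l * (d c m l + d m l c - d l c m))) - 2⁻¹ * (∑ l, u m l
        * (d c a2 l + d a2 l c - d l c a2)) * (2⁻¹ * (∑ l, u c l * (d a1 m l + d m l a1 - d l a1
        m)))))))) - 2⁻¹ * u μ ν * (∑ a1, ∑ a2, u a1 a2 * (∑ c, (2⁻¹ * (∑ l, -((∑ v1, ∑ v2, u c v1 *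
        u v2 l * d c v1 v2) * (d a1 a2 l + d a2 l a1 - d l a1 a2))) - 2⁻¹ * (∑ l, -((∑ v1, ∑ v2, u c
        v1 * u v2 l * d a1 v1 v2) * (d c a2 l + d a2 l c - d l c a2))) + (∑ m, (2⁻¹ * (∑ l, u m l *
        (d a1 a2 l + d a2 l a1 - d l a1 a2)) * (2⁻¹ * (∑ l, u c l * (d c m l + d m l c - d l c m)))
        - 2⁻¹ * (∑ l, u m l * (d c a2 l + d a2 l c - d l c a2)) * (2⁻¹ * (∑ l, u c l * (d a1 m l + d
        m l a1 - d l a1 m))))))))) := by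
  have hsym := symbol_identity D u dd hu hdd₁ hdd₂ μ ν
  set L : Fin 4 → Fin 4 → ℝ := fun α β ↦
    (-(D * (∑ t1, ∑ t2, u t1 t2 * dd α β t2 t1))) * (u μ ν * u β α - u β ν * u μ α) + D * ((∑ w1, ∑
      w2, u μ w1 * u w2 ν * dd α β w1 w2) * u β α + u μ ν * (∑ w1, ∑ w2, u β w1 * u w2 α * dd α β w1
      w2) - (∑ w1, ∑ w2, u β w1 * u w2 ν * dd α β w1 w2) * u μ α - u β ν * (∑ w1, ∑ w2, u μ w1 * u
      w2 α * dd α β w1 w2)) with hL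
  set Q : Fin 4 → Fin 4 → ℝ := fun α β ↦
    (-(D * (∑ t1, ∑ t2, u t1 t2 * d α t2 t1) * (∑ t1, ∑ t2, u t1 t2 * d β t2 t1) + D * (∑ t1, ∑ t2,
      -((∑ v1, ∑ v2, u t1 v1 * u v2 t2 * d α v1 v2) * d β t2 t1)))) * (u μ ν * u β α - u β ν * u μ
      α) + D * (∑ t1, ∑ t2, u t1 t2 * d β t2 t1) * ((∑ v1, ∑ v2, u μ v1 * u v2 ν * d α v1 v2) * u β
      α + u μ ν * (∑ v1, ∑ v2, u β v1 * u v2 α * d α v1 v2) - (∑ v1, ∑ v2, u β v1 * u v2 ν * d α v1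
      v2) * u μ α - u β ν * (∑ v1, ∑ v2, u μ v1 * u v2 α * d α v1 v2)) + D * (∑ t1, ∑ t2, u t1 t2 *
      d α t2 t1) * ((∑ v1, ∑ v2, u μ v1 * u v2 ν * d β v1 v2) * u β α + u μ ν * (∑ v1, ∑ v2, u β v1
      * u v2 α * d β v1 v2) - (∑ v1, ∑ v2, u β v1 * u v2 ν * d β v1 v2) * u μ α - u β ν * (∑ v1, ∑
      v2, u μ v1 * u v2 α * d β v1 v2)) + D * ((∑ w1, ∑ w2, (-((∑ v1, ∑ v2, u μ v1 * u v2 w1 * d α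
      v1 v2) * u w2 ν * d β w1 w2) - u μ w1 * (∑ v1, ∑ v2, u w2 v1 * u v2 ν * d α v1 v2) * d β w1
      w2)) * u β α + (∑ v1, ∑ v2, u μ v1 * u v2 ν * d β v1 v2) * (-(∑ v1, ∑ v2, u β v1 * u v2 α * d
      α v1 v2)) + (-(∑ v1, ∑ v2, u μ v1 * u v2 ν * d α v1 v2)) * (∑ v1, ∑ v2, u β v1 * u v2 α * d β
      v1 v2) + u μ ν * (∑ w1, ∑ w2, (-((∑ v1, ∑ v2, u β v1 * u v2 w1 * d α v1 v2) * u w2 α * d β w1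
      w2) - u β w1 * (∑ v1, ∑ v2, u w2 v1 * u v2 α * d α v1 v2) * d β w1 w2)) - (∑ w1, ∑ w2, (-((∑
      v1, ∑ v2, u β v1 * u v2 w1 * d α v1 v2) * u w2 ν * d β w1 w2) - u β w1 * (∑ v1, ∑ v2, u w2 v1
      * u v2 ν * d α v1 v2) * d β w1 w2)) * u μ α - (∑ v1, ∑ v2, u β v1 * u v2 ν * d β v1 v2) * (-(∑
      v1, ∑ v2, u μ v1 * u v2 α * d α v1 v2)) - (-(∑ v1, ∑ v2, u β v1 * u v2 ν * d α v1 v2)) * (∑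
      v1, ∑ v2, u μ v1 * u v2 α * d β v1 v2) - u β ν * (∑ w1, ∑ w2, (-((∑ v1, ∑ v2, u μ v1 * u v2 w1
      * d α v1 v2) * u w2 α * d β w1 w2) - u μ w1 * (∑ v1, ∑ v2, u w2 v1 * u v2 α * d α v1 v2) * d β
      w1 w2))) with hQ
  set GLi : ℝ :=
    (∑ a1, ∑ a2, u μ a1 * u ν a2 * (∑ c, (2⁻¹ * (∑ l, u c l * (dd c a1 a2 l + dd c a2 l a1 - dd c l
      a1 a2)) - 2⁻¹ * (∑ l, u c l * (dd a1 c a2 l + dd a1 a2 l c - dd a1 l c a2))))) - 2⁻¹ * u μ ν *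
      (∑ a1, ∑ a2, u a1 a2 * (∑ c, (2⁻¹ * (∑ l, u c l * (dd c a1 a2 l + dd c a2 l a1 - dd c l a1
      a2)) - 2⁻¹ * (∑ l, u c l * (dd a1 c a2 l + dd a1 a2 l c - dd a1 l c a2))))) with hGLi
  set GQu : ℝ :=
    (∑ a1, ∑ a2, u μ a1 * u ν a2 * (∑ c, (2⁻¹ * (∑ l, -((∑ v1, ∑ v2, u c v1 * u v2 l * d c v1 v2) *
      (d a1 a2 l + d a2 l a1 - d l a1 a2))) - 2⁻¹ * (∑ l, -((∑ v1, ∑ v2, u c v1 * u v2 l * d a1 v1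
      v2) * (d c a2 l + d a2 l c - d l c a2))) + (∑ m, (2⁻¹ * (∑ l, u m l * (d a1 a2 l + d a2 l a1 -
      d l a1 a2)) * (2⁻¹ * (∑ l, u c l * (d c m l + d m l c - d l c m))) - 2⁻¹ * (∑ l, u m l * (d c
      a2 l + d a2 l c - d l c a2)) * (2⁻¹ * (∑ l, u c l * (d a1 m l + d m l a1 - d l a1 m)))))))) -
      2⁻¹ * u μ ν * (∑ a1, ∑ a2, u a1 a2 * (∑ c, (2⁻¹ * (∑ l, -((∑ v1, ∑ v2, u c v1 * u v2 l * d c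
      v1 v2) * (d a1 a2 l + d a2 l a1 - d l a1 a2))) - 2⁻¹ * (∑ l, -((∑ v1, ∑ v2, u c v1 * u v2 l *
      d a1 v1 v2) * (d c a2 l + d a2 l c - d l c a2))) + (∑ m, (2⁻¹ * (∑ l, u m l * (d a1 a2 l + d
      a2 l a1 - d l a1 a2)) * (2⁻¹ * (∑ l, u c l * (d c m l + d m l c - d l c m))) - 2⁻¹ * (∑ l, u m
      l * (d c a2 l + d a2 l c - d l c a2)) * (2⁻¹ * (∑ l, u c l * (d a1 m l + d m l a1 - d l a1
      m)))))))) with hGQu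
  have hsym' : (∑ α, ∑ β, L α β) + 2 * D * GLi = 0 := hsym
  show -(∑ α, (16 * Real.pi)⁻¹ * ∑ β, (L α β + Q α β)) - (8 * Real.pi)⁻¹ * D * (GLi + GQu)
    = -(∑ α, (16 * Real.pi)⁻¹ * ∑ β, Q α β) - (8 * Real.pi)⁻¹ * D * GQu
  simp only [Finset.sum_add_distrib, mul_add]
  simp only [← Finset.mul_sum]
  linear_combination (-(16 * Real.pi)⁻¹) * hsym'

/-! ### Registered sub-goal form -/

/-- Registered sub-goal form (part 5) of `symbol_identity` (LL's cancellation of second derivatives). [cite: LandauLifshitz1975, §96 (96.4)] -/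
theorem pseudotensorBound_symbol_identity : ∀ (D : ℝ) (u : Fin 4 → Fin 4 → ℝ) (dd : Fin 4 → Fin 4 → Fin 4 → Fin 4 → ℝ), (∀ i j, u i j = u j i) → (∀ a b i j, dd a b i j = dd b a i j) → (∀ a b i j, dd a b i j = dd a b j i) → ∀ μ ν : Fin 4, (∑ α, ∑ β, ((-(D * (∑ t1, ∑ t2, u t1 t2 * dd α β t2 t1))) * (u μ ν * u β α - u β ν * u μ α) + D * ((∑ w1, ∑ w2, u μ w1 * u w2 ν * dd α β w1 w2) * u β α + u μ ν * (∑ w1, ∑ w2, u β w1 * u w2 α * dd α β w1 w2) - (∑ w1, ∑ w2, u β w1 * u w2 ν * dd α β w1 w2) * u μ α - u β ν * (∑ w1, ∑ w2, u μ w1 * u w2 α * dd α β w1 w2)))) + 2 * D * ((∑ a1, ∑ a2, u μ a1 * u ν a2 * (∑ c, (2⁻¹ * (∑ l, u c l * (dd c a1 a2 l + dd c a2 l a1 - dd c l a1 a2)) - 2⁻¹ * (∑ l, u c l * (dd a1 c a2 l + dd a1 a2 l c - dd a1 l c a2))))) - 2⁻¹ * u μ ν * (∑ a1, ∑ a2,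 u a1 a2 * (∑ c, (2⁻¹ * (∑ l, u c l * (dd c a1 a2 l + dd c a2 l a1 - dd c l a1 a2)) - 2⁻¹ * (∑ l, u c l * (dd a1 c a2 l + dd a1 a2 l c - dd a1 l c a2)))))) = 0 :=
  fun D u dd hu h₁ h₂ μ ν ↦ symbol_identity D u dd hu h₁ h₂ μ ν

end Summit.FinalStateConjecture.FinalStateConjecture.Theorems.SublinearIsFree.PseudotensorBound
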